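import Summits.Ventures.HSemireg.SignedPureWeilFourierCertificate
import Summits.Ventures.HSemireg.SignedPureWeilTransport

/-!
# Venture HSemireg — THE TWIST LATTICE IS SATURATED (every n): an integer design on (ℤ∕4)ⁿ all of whose 3ⁿ pattern moments vanish
# («invisible»: pure AND Weil-dead) is EXACTLY an integer combination `Σ_k (−1)^{x_k}·H_k(x without x_k)` of sign-twisted lifts, with
# INTEGER tables and no denominator; hence the Fourier-side purity certificate of `SignedPureWeilFourierCertificate.lean` EXISTS for every
# pure design (`pure ↔ certificate`), a pure design is determined by its Weil moment up to an integer twist sum, and the space of signed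
# pure-Weil designs is `ℤ·(waves) + (twist lattice)` up to the factor 4ⁿ on the wave part

HONEST FRAMING. Part of the Lean index of the computation cell `pub-hsemireg` (Sunday typer seat p9, § g = 8; family B row **B20-3** of
`target-g8/CENSUS.md`: signed pure-Weil unit-graph designs are «class witnesses — cycles with ℤ-coefficients — not census objects»).
FINITE GAUSSIAN-INTEGER ARITHMETIC ONLY, in the vocabulary of `SignedPureWeilLadder.lean` ∕ `SignedPureWeilFourierCertificate.lean`
(`Letter`, `Eps`, `vmoment`, `plus`, `minus`, `sl`, `G`, `four_mul_pair`, `sgnTab`, `cosTab`, `sinTab`, `lsum`, `cwave`, `swave`,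
`pure_of_fourierCert`). No abelian variety, cycle, sheaf or semiregularity map is constructed; t-20's dictionary (LEMMA W) is text of
record, not a binder; nothing here says that HC ∕ HC_CM ∕ HC_AV holds; no object is certified; no Literature fact is declared; no verdict ∕
door word ∕ count of the cell moves.

THE STATEMENTS (every n). Call an integer design `f : (ℤ∕4)ⁿ → ℤ` INVISIBLE if `f̂(ε) = 0` for ALL `ε ∈ {0, ±1}ⁿ` (the 3ⁿ − 2 visible
patterns AND the two Weil patterns) — equivalently, its Fourier transform lives on `{a : some a_k = 2}`. A TWIST SUM is a design of the
form `x ↦ Σ_k (−1)^{x_k}·H_k(x with x_k := 0)` with integer tables `H_k` (the sign-twisted lifts `signTwist` of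
`SignedPureWeilFourierCertificate.lean`, written with `Function.update x k 0` in place of `Fin.removeNth` so that the notion makes sense
for every n, n = 0 included; §5 converts back).
* §2 `invisible_of_isTwistSum`: twist sums are invisible (this is `vmoment_signTwist`, re-derived in the present form).
* §3 **`isTwistSum_of_invisible` (SATURATION):** every invisible INTEGER design is a twist sum with INTEGER tables. Over ℚ this is
  Fourier inversion; the integral statement says that the lattice `Σ_k (−1)^{x_k}·ℤ^{(ℤ∕4)ⁿ⁻¹}` is saturated in `ℤ^{(ℤ∕4)ⁿ}`. PROOF by
  slicing along factor 0 (no Fourier inversion, no `decide`): the four adjacent slice-pair sums `sl f a` of an invisible design are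
  invisible (`four_mul_pair`: `4·(G(a) + G(a+1)) = 2·f̂(0,ε') + u·f̂(+,ε') + ū·f̂(−,ε') = 0`), hence twist sums on (ℤ∕4)ⁿ⁻¹ by induction,
  and `f(b, x') = (−1)^b·f(0, x') + g_b(x')` with `g_0 = 0`, `g_1 = sl f 0`, `g_2 = sl f 1 − sl f 0`, `g_3 = sl f 3` (`head_add_glue`);
  glueing the four twist sums `g_b` along factor 0 is a twist sum along the factors ≥ 1 (`IsTwistSum.glue`).
* §4 the Weil moments of the two waves: `2·ĉwave(+) = 4ⁿ`, `2i·ŝwave(+) = −4ⁿ` (n ≥ 1; `charsum_eq_zero`).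
* §5 **`exists_fourierCert_of_pure`:** every PURE integer design `m` on (ℤ∕4)ⁿ⁺¹ satisfies, letter by letter,
  `4ⁿ⁺¹·m(x) = 2·Re W·cos(π∕2·Σx) + 2·Im W·sin(π∕2·Σx) + Σ_k (−1)^{x_k}·H_k(x without x_k)` with INTEGER tables `H_k` (`W = m̂(+,…,+)`):
  the design `4ⁿ⁺¹·m − 2 Re W·cwave − 2 Im W·swave` is invisible, so §3 applies. Hence **`pure_iff_fourierCert`** (the converse of
  `pure_of_fourierCert` — the certificate method is COMPLETE), **`pure_dead_iff_isTwistSum`** (a pure design is Weil-dead iff it is an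
  integer twist sum — no denominator) and **`sub_isTwistSum_of_vmoment_eq`** (two pure designs with the same Weil moment differ by an
  integer twist sum): the abelian group of signed pure-Weil integer designs on (ℤ∕4)ⁿ⁺¹ is an extension of a rank-2 group (the Weil
  moment) by the twist lattice, and s(n+1) (the minimal support of a W-alive pure design; s(1..4) = 2, 4, 14, 28 and 32 ≤ s(5) ≤ 80
  in the kernel — `s4_bracket`, `s5_bracket` — and s(5) ≥ 66 machine of record) is the minimal Hamming weight in the non-trivial cosets of
  the twist lattice inside that group.

WHAT IS NOT HERE. Any support bound; the exact denominator on the wave part (4ⁿ⁺¹ suffices; by the dyadic valuation of W a smaller power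
of 2 does); LEMMA W; anything about sheaves or semiregularity.
-/

namespace Summit.Ventures.HSemireg.SignedWeilDesignN

open Finset

variable {n : ℕ}

/-! ## §1 Twist sums (every n) -/

/-- `f` is an (integer) TWIST SUM: `f(x) = Σ_k (−1)^{x_k}·H_k(x with x_k := 0)` for some integer tables `H_k` on (ℤ∕4)ⁿ
(only the values of `H_k` at letters with `x_k = 0` matter). [definition of this file] -/
def IsTwistSum (f : Letter n → ℤ) : Prop :=
  ∃ H : Fin n → Letter n → ℤ, ∀ x, f x = ∑ k, sgnTab (x k) * H k (Function.update x k 0)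

/-- The zero design is a twist sum. -/
theorem IsTwistSum.zero : IsTwistSum (fun _ : Letter n => (0 : ℤ)) :=
  ⟨fun _ _ => 0, fun x => by simp⟩

/-- Twist sums are closed under addition. -/
theorem IsTwistSum.add {f g : Letter n → ℤ} (hf : IsTwistSum f) (hg : IsTwistSum g) :
    IsTwistSum (fun x => f x + g x) := by
  obtain ⟨H, hH⟩ := hf
  obtain ⟨H', hH'⟩ := hg
  refine ⟨fun k y => H k y + H' k y, fun x => ?_⟩
  dsimp only
  rw [hH x, hH' x, ← Finset.sum_add_distrib]
  exact Finset.sum_congr rfl (fun k _ => by ring)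

/-- Twist sums are closed under subtraction. -/
theorem IsTwistSum.sub {f g : Letter n → ℤ} (hf : IsTwistSum f) (hg : IsTwistSum g) :
    IsTwistSum (fun x => f x - g x) := by
  obtain ⟨H, hH⟩ := hf
  obtain ⟨H', hH'⟩ := hg
  refine ⟨fun k y => H k y - H' k y, fun x => ?_⟩
  dsimp only
  rw [hH x, hH' x, ← Finset.sum_sub_distrib]
  exact Finset.sum_congr rfl (fun k _ => by ring)

/-- A twist sum stays a twist sum after changing it by a pointwise-equal function. -/
theorem IsTwistSum.congr {f g : Letter n → ℤ} (hf : IsTwistSum f) (hfg : ∀ x, f x = g x) : IsTwistSum g := by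
  obtain ⟨H, hH⟩ := hf
  exact ⟨H, fun x => by rw [← hfg x, hH x]⟩

/-- **THE HEAD TWIST:** `x ↦ (−1)^{x₀}·f(0, x')` is a twist sum (table `H₀ = f`, the other tables zero). -/
theorem IsTwistSum.head (f : Letter (n + 1) → ℤ) :
    IsTwistSum (fun x : Letter (n + 1) => sgnTab (x 0) * f (Function.update x 0 0)) := by
  classical
  refine ⟨fun k y => if k = 0 then f y else 0, fun x => ?_⟩
  rw [Fin.sum_univ_succ]
  simp [Fin.succ_ne_zero]

/-- **GLUEING ALONG FACTOR 0:** if each of the four slices `g b` (designs on (ℤ∕4)ⁿ) is a twist sum, then the design on (ℤ∕4)ⁿ⁺¹ whose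
slice at `x₀ = b` is `g b` is a twist sum (along the factors ≥ 1; tables `H'_{k+1}(y) = H_{y₀, k}(tail y)`, `H'_0 = 0`). -/
theorem IsTwistSum.glue (g : Fin 4 → Letter n → ℤ) (hg : ∀ b, IsTwistSum (g b)) :
    IsTwistSum (fun x : Letter (n + 1) => g (x 0) (Fin.tail x)) := by
  classical
  choose H hH using hg
  refine ⟨Fin.cons (fun _ => 0) (fun k y => H (y 0) k (Fin.tail y)), fun x => ?_⟩
  dsimp only
  rw [hH (x 0) (Fin.tail x), Fin.sum_univ_succ]
  simp only [Fin.cons_zero, mul_zero, zero_add, Fin.cons_succ]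
  refine Finset.sum_congr rfl (fun k _ => ?_)
  have h0 : Function.update x k.succ 0 0 = x 0 := Function.update_of_ne (Fin.succ_ne_zero k).symm _ _
  rw [h0, Fin.tail_update_succ]
  rfl

/-! ## §2 Invisible designs; twist sums are invisible -/

/-- `f` is INVISIBLE if ALL its 3ⁿ pattern moments vanish (the visible ones and the two Weil ones): its Fourier transform lives on
`{a : some a_k = 2}`. [definition of this file] -/
def Invisible (f : Letter n → ℤ) : Prop := ∀ ε : Eps n, vmoment f ε = 0

/-- One twist term `x ↦ (−1)^{x_k}·H(x with x_k := 0)` has no pattern moments at all: it is the sign-twisted lift `signTwist k`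
of the table `y ↦ H(y with 0 inserted at k)`, so `vmoment_signTwist` applies (there is no `k` when n = 0). -/
theorem vmoment_twistTerm : ∀ {n : ℕ} (k : Fin n) (H : Letter n → ℤ) (ε : Eps n),
    vmoment (fun x => sgnTab (x k) * H (Function.update x k 0)) ε = 0
  | 0, k, _, _ => k.elim0
  | _ + 1, k, H, ε => by
    have hfun : (fun x => sgnTab (x k) * H (Function.update x k 0)) = signTwist k (fun y => H (Fin.insertNth k 0 y)) := by
      funext x; simp only [signTwist, Fin.insertNth_removeNth]
    rw [hfun]
    exact vmoment_signTwist k _ ε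

/-- **TWIST SUMS ARE INVISIBLE.** -/
theorem invisible_of_isTwistSum {f : Letter n → ℤ} (hf : IsTwistSum f) : Invisible f := by
  obtain ⟨H, hH⟩ := hf
  intro ε
  have hfun : f = fun x => ∑ k ∈ Finset.univ, (fun k x => sgnTab (x k) * H k (Function.update x k 0)) k x := funext hH
  rw [hfun, vmoment_finsum]
  exact Finset.sum_eq_zero (fun k _ => vmoment_twistTerm k (H k) ε)

/-! ## §3 Saturation: invisible integer designs are integer twist sums -/

/-- The adjacent slice-pair sums of an invisible design are invisible (`four_mul_pair` with all three moments on the right zero). -/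
theorem invisible_sl {f : Letter (n + 1) → ℤ} (hf : Invisible f) (a : Fin 4) : Invisible (sl f a) := by
  intro ε'
  have h4 := four_mul_pair f ε' a
  rw [hf, hf, hf, mul_zero, mul_zero, mul_zero, add_zero, add_zero] at h4
  rw [vmoment_sl]
  rcases mul_eq_zero.mp h4 with h | h
  · exact absurd h (by decide)
  · exact h

/-- An invisible design on (ℤ∕4)⁰ (a single number, equal to its own empty-pattern moment) is zero. -/
theorem eq_zero_of_invisible_zero (f : Letter 0 → ℤ) (hf : Invisible f) (x : Letter 0) : f x = 0 := by
  have h := hf (fun k => k.elim0)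
  unfold vmoment at h
  have hchi : ∀ (ε : Eps 0) (y : Letter 0), vchi ε y = 1 := by
    intro ε y; simp [vchi, expo, unitTab]
  simp only [hchi, mul_one] at h
  rw [Fintype.sum_eq_single x (fun y hy => absurd (Subsingleton.elim y x) hy)] at h
  exact_mod_cast h

/-- **THE SLICE DECOMPOSITION** `f(b, x') = (−1)^b·f(0, x') + g_b(x')` with `g_0 = 0`, `g_1 = sl f 0`, `g_2 = sl f 1 − sl f 0`,
`g_3 = sl f 3` — valid for EVERY design. -/
def glueSlices (f : Letter (n + 1) → ℤ) : Fin 4 → Letter n → ℤ :=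
  ![fun _ => 0, sl f 0, fun x' => sl f 1 x' - sl f 0 x', sl f 3]

/-- The slice decomposition holds letter by letter. -/
theorem head_add_glue (f : Letter (n + 1) → ℤ) (x : Letter (n + 1)) :
    f x = sgnTab (x 0) * f (Function.update x 0 0) + glueSlices f (x 0) (Fin.tail x) := by
  have hx : x = Fin.cons (x 0) (Fin.tail x) := (Fin.cons_self_tail x).symm
  have hup : Function.update x 0 0 = Fin.cons 0 (Fin.tail x) := by
    rw [hx, Fin.update_cons_zero, Fin.tail_cons]
  rw [hup]
  conv_lhs => rw [hx]
  generalize Fin.tail x = y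
  generalize x 0 = b
  fin_cases b
  · simp [glueSlices, sgnTab]
  · simp [glueSlices, sgnTab, sl]
  · have h01 : ((0 : Fin 4) + 1) = 1 := by decide
    have h11 : ((1 : Fin 4) + 1) = 2 := by decide
    simp [glueSlices, sgnTab, sl, h01, h11]
    ring
  · have h31 : ((3 : Fin 4) + 1) = 0 := by decide
    simp [glueSlices, sgnTab, sl, h31]

/-- **SATURATION OF THE TWIST LATTICE:** an invisible INTEGER design on (ℤ∕4)ⁿ is a twist sum with INTEGER tables (every n). -/
theorem isTwistSum_of_invisible : ∀ (n : ℕ) (f : Letter n → ℤ), Invisible f → IsTwistSum f := by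
  intro n
  induction n with
  | zero =>
    intro f hf
    exact IsTwistSum.zero.congr (fun x => (eq_zero_of_invisible_zero f hf x).symm)
  | succ n ih =>
    intro f hf
    -- the four glued slices are twist sums on (ℤ∕4)ⁿ
    have hg : ∀ b, IsTwistSum (glueSlices f b) := by
      have h0 := invisible_sl hf 0
      have h1 := invisible_sl hf 1
      have h3 := invisible_sl hf 3
      intro b
      fin_cases b
      · exact IsTwistSum.zero
      · exact ih _ h0
      · exact (ih _ h1).sub (ih _ h0)
      · exact ih _ h3
    exact ((IsTwistSum.head f).add (IsTwistSum.glue (glueSlices f) hg)).congr (fun x => (head_add_glue f x).symm)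

/-- **INVISIBLE ⟺ TWIST SUM** (every n). -/
theorem invisible_iff_isTwistSum (f : Letter n → ℤ) : Invisible f ↔ IsTwistSum f :=
  ⟨isTwistSum_of_invisible n f, invisible_of_isTwistSum⟩

/-! ## §4 The Weil moments of the two waves -/

/-- `Σ_x i^{2·Σx} = 0` on (ℤ∕4)ⁿ⁺¹ (a non-trivial character). -/
theorem sum_unitTab_two_lsum : (∑ x : Letter (n + 1), unitTab (2 * lsum x)) = 0 := by
  have e : ∀ x : Letter (n + 1), 2 * lsum x = ∑ j, (fun _ => (2 : Fin 4)) j * x j := by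
    intro x; simp only [lsum, Finset.mul_sum]
  simp_rw [e]
  exact charsum_eq_zero (fun _ => (2 : Fin 4)) 0 (by decide)

/-- The number of letters: `#(ℤ∕4)ⁿ = 4ⁿ`, as a Gaussian integer. -/
theorem sum_one_letter : (∑ _x : Letter n, (1 : GaussianInt)) = 4 ^ n := by
  simp

/-- `expo plus x = Σx`. -/
theorem expo_plus_eq_lsum (x : Letter n) : expo plus x = lsum x := by
  simp [expo, plus, coef, lsum]

/-- `expo minus x = −Σx`. -/
theorem expo_minus_eq_neg_lsum (x : Letter n) : expo minus x = -lsum x := by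
  have h3 : ∀ u : Fin 4, (3 : Fin 4) * u = -u := by decide
  have hc : coef (2 : Fin 3) = 3 := by decide
  simp only [expo, minus, hc, h3, lsum, Finset.sum_neg_distrib]

/-- `s + s = 2s` in ℤ∕4. -/
theorem add_self_eq_two_mul_fin4 : ∀ s : Fin 4, s + s = 2 * s := by decide

/-- `i⁰ = 1` on the table. -/
theorem unitTab_zero : unitTab 0 = 1 := by decide

/-- **`2·ĉwave(+,…,+) = 4ⁿ⁺¹`.** -/
theorem two_mul_vmoment_cwave_plus : (2 : GaussianInt) * vmoment (cwave : Letter (n + 1) → ℤ) plus = 4 ^ (n + 1) := by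
  unfold vmoment
  rw [Finset.mul_sum]
  have : ∀ x : Letter (n + 1), (2 : GaussianInt) * ((cwave x : ℤ) * vchi plus x) = unitTab (2 * lsum x) + 1 := by
    intro x
    rw [← mul_assoc, cwave, two_mul_cosTab, vchi, expo_plus_eq_lsum, add_mul, ← unitTab_add, ← unitTab_add, neg_add_cancel,
      add_self_eq_two_mul_fin4, unitTab_zero]
  simp_rw [this]
  rw [Finset.sum_add_distrib, sum_unitTab_two_lsum, zero_add, sum_one_letter]

/-- **`2i·ŝwave(+,…,+) = −4ⁿ⁺¹`.** -/
theorem twoI_mul_vmoment_swave_plus : (⟨0, 2⟩ : GaussianInt) * vmoment (swave : Letter (n + 1) → ℤ) plus = -4 ^ (n + 1) := by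
  unfold vmoment
  rw [Finset.mul_sum]
  have : ∀ x : Letter (n + 1), (⟨0, 2⟩ : GaussianInt) * ((swave x : ℤ) * vchi plus x) = unitTab (2 * lsum x) - 1 := by
    intro x
    rw [← mul_assoc, swave, twoI_mul_sinTab, vchi, expo_plus_eq_lsum, sub_mul, ← unitTab_add, ← unitTab_add, neg_add_cancel,
      add_self_eq_two_mul_fin4, unitTab_zero]
  simp_rw [this]
  rw [Finset.sum_sub_distrib, sum_unitTab_two_lsum, zero_sub, sum_one_letter]

/-! ## §5 The Fourier-side certificate exists for every pure design -/

/-- The wave part of a pure design: `2·Re W·cos + 2·Im W·sin` removes the Weil moments of `4ⁿ⁺¹·m` — the difference is invisible. -/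
theorem invisible_sub_waves (m : Letter (n + 1) → ℤ) (hpure : ∀ ε : Eps (n + 1), ε ≠ plus → ε ≠ minus → vmoment m ε = 0) :
    Invisible (fun x => 4 ^ (n + 1) * m x -
      ((2 * (vmoment m plus).re) * cwave x + (2 * (vmoment m plus).im) * swave x)) := by
  -- it suffices to treat the plus pattern: visible ones are killed by purity of all three terms, minus is the conjugate of plus
  have hlin : ∀ ε : Eps (n + 1), vmoment (fun x => 4 ^ (n + 1) * m x -
      ((2 * (vmoment m plus).re) * cwave x + (2 * (vmoment m plus).im) * swave x)) ε =
      (4 ^ (n + 1) : GaussianInt) * vmoment m ε - (((2 * (vmoment m plus).re : ℤ) : GaussianInt) * vmoment cwave ε +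
        ((2 * (vmoment m plus).im : ℤ) : GaussianInt) * vmoment swave ε) := by
    intro ε
    unfold vmoment
    rw [Finset.mul_sum, Finset.mul_sum, Finset.mul_sum, ← Finset.sum_add_distrib, ← Finset.sum_sub_distrib]
    refine Finset.sum_congr rfl (fun x _ => ?_)
    push_cast
    ring
  have hplus : vmoment (fun x => 4 ^ (n + 1) * m x -
      ((2 * (vmoment m plus).re) * cwave x + (2 * (vmoment m plus).im) * swave x)) plus = 0 := by
    rw [hlin]
    -- multiply by 2i·2 = 4i to use the two wave moments
    have key : (2 : GaussianInt) * ⟨0, 2⟩ * ((4 ^ (n + 1) : GaussianInt) * vmoment m plus -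
        (((2 * (vmoment m plus).re : ℤ) : GaussianInt) * vmoment (cwave : Letter (n + 1) → ℤ) plus +
         ((2 * (vmoment m plus).im : ℤ) : GaussianInt) * vmoment (swave : Letter (n + 1) → ℤ) plus)) = 0 := by
      have e : (2 : GaussianInt) * ⟨0, 2⟩ * ((4 ^ (n + 1) : GaussianInt) * vmoment m plus -
          (((2 * (vmoment m plus).re : ℤ) : GaussianInt) * vmoment (cwave : Letter (n + 1) → ℤ) plus +
           ((2 * (vmoment m plus).im : ℤ) : GaussianInt) * vmoment (swave : Letter (n + 1) → ℤ) plus)) =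
          (2 : GaussianInt) * ⟨0, 2⟩ * 4 ^ (n + 1) * vmoment m plus -
          (⟨0, 2⟩ * ((2 * (vmoment m plus).re : ℤ) : GaussianInt) * ((2 : GaussianInt) * vmoment (cwave : Letter (n + 1) → ℤ) plus) +
           2 * ((2 * (vmoment m plus).im : ℤ) : GaussianInt) * ((⟨0, 2⟩ : GaussianInt) * vmoment (swave : Letter (n + 1) → ℤ) plus)) := by ring
      rw [e, two_mul_vmoment_cwave_plus, twoI_mul_vmoment_swave_plus]
      -- now an identity in ℤ[i] between W, Re W, Im W
      set W := vmoment m plus with hW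
      have hWd : W = ⟨W.re, W.im⟩ := rfl
      rw [hWd]
      ext <;> simp <;> ring
    rcases mul_eq_zero.mp key with h | h
    · exact absurd h (by decide)
    · exact h
  intro ε
  by_cases hp : ε = plus
  · rw [hp]; exact hplus
  by_cases hm : ε = minus
  · rw [hm, vmoment_minus_eq_star, hplus, star_zero]
  rw [hlin, hpure ε hp hm, vmoment_cwave ε hp hm, vmoment_swave ε hp hm]
  simp

/-- **THE CERTIFICATE EXISTS (converse of `pure_of_fourierCert`):** every pure integer design `m` on (ℤ∕4)ⁿ⁺¹ satisfies
`4ⁿ⁺¹·m(x) = 2 Re W·cos(π∕2·Σx) + 2 Im W·sin(π∕2·Σx) + Σ_k (−1)^{x_k}·H_k(x without x_k)` at every letter, with INTEGER tables `H_k`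
on (ℤ∕4)ⁿ and `W = m̂(+,…,+)`. -/
theorem exists_fourierCert_of_pure (m : Letter (n + 1) → ℤ)
    (hpure : ∀ ε : Eps (n + 1), ε ≠ plus → ε ≠ minus → vmoment m ε = 0) :
    ∃ H : Fin (n + 1) → Letter n → ℤ, ∀ x,
      4 ^ (n + 1) * m x = (2 * (vmoment m plus).re) * cosTab (lsum x) + (2 * (vmoment m plus).im) * sinTab (lsum x) +
        ∑ k, sgnTab (x k) * H k (k.removeNth x) := by
  obtain ⟨H, hH⟩ := isTwistSum_of_invisible (n + 1) _ (invisible_sub_waves m hpure)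
  refine ⟨fun k y => H k (Fin.insertNth k 0 y), fun x => ?_⟩
  have h := hH x
  simp only [Fin.insertNth_removeNth]
  rw [← h]
  simp only [cwave, swave]
  ring

/-- **PURE ⟺ FOURIER-SIDE CERTIFICATE** (the certificate method of `SignedPureWeilFourierCertificate.lean` is complete). -/
theorem pure_iff_fourierCert (m : Letter (n + 1) → ℤ) :
    (∀ ε : Eps (n + 1), ε ≠ plus → ε ≠ minus → vmoment m ε = 0) ↔
      ∃ (D A B : ℤ) (H : Fin (n + 1) → Letter n → ℤ), D ≠ 0 ∧
        ∀ x, D * m x = A * cosTab (lsum x) + B * sinTab (lsum x) + ∑ k, sgnTab (x k) * H k (k.removeNth x) := by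
  constructor
  · intro hp
    obtain ⟨H, hH⟩ := exists_fourierCert_of_pure m hp
    exact ⟨4 ^ (n + 1), _, _, H, by positivity, hH⟩
  · rintro ⟨D, A, B, H, hD, h⟩
    exact pure_of_fourierCert m D A B hD H h

/-- Twist sums in the `Fin.removeNth` form of `SignedPureWeilFourierCertificate.lean` are twist sums. -/
theorem isTwistSum_of_removeNth (f : Letter (n + 1) → ℤ) (H : Fin (n + 1) → Letter n → ℤ)
    (h : ∀ x, f x = ∑ k, sgnTab (x k) * H k (k.removeNth x)) : IsTwistSum f := by
  refine ⟨fun k y => H k (k.removeNth y), fun x => ?_⟩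
  rw [h x]
  refine Finset.sum_congr rfl (fun k _ => ?_)
  congr 2
  funext j
  simp only [Fin.removeNth, Function.update_of_ne (Fin.succAbove_ne k j)]

/-- **A PURE DESIGN IS WEIL-DEAD IFF IT IS AN INTEGER TWIST SUM** (no denominator: saturation). -/
theorem pure_dead_iff_isTwistSum (m : Letter (n + 1) → ℤ) :
    ((∀ ε : Eps (n + 1), ε ≠ plus → ε ≠ minus → vmoment m ε = 0) ∧ vmoment m plus = 0) ↔
      ∃ H : Fin (n + 1) → Letter n → ℤ, ∀ x, m x = ∑ k, sgnTab (x k) * H k (k.removeNth x) := by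
  constructor
  · rintro ⟨hp, hW⟩
    have hinv : Invisible m := by
      intro ε
      by_cases h1 : ε = plus
      · rw [h1, hW]
      by_cases h2 : ε = minus
      · rw [h2, vmoment_minus_eq_star, hW, star_zero]
      exact hp ε h1 h2
    obtain ⟨H, hH⟩ := isTwistSum_of_invisible (n + 1) m hinv
    refine ⟨fun k y => H k (Fin.insertNth k 0 y), fun x => ?_⟩
    simp only [Fin.insertNth_removeNth]
    exact hH x
  · rintro ⟨H, hH⟩
    have hinv : Invisible m := invisible_of_isTwistSum (isTwistSum_of_removeNth m H hH)
    exact ⟨fun ε _ _ => hinv ε, hinv plus⟩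

/-- **THE WEIL MOMENT DETERMINES A PURE DESIGN UP TO AN INTEGER TWIST SUM:** two pure designs on (ℤ∕4)ⁿ⁺¹ with the same Weil moment
differ by a twist sum with integer tables. -/
theorem sub_isTwistSum_of_vmoment_eq (m m' : Letter (n + 1) → ℤ)
    (hpure : ∀ ε : Eps (n + 1), ε ≠ plus → ε ≠ minus → vmoment m ε = 0)
    (hpure' : ∀ ε : Eps (n + 1), ε ≠ plus → ε ≠ minus → vmoment m' ε = 0)
    (hW : vmoment m plus = vmoment m' plus) :
    ∃ H : Fin (n + 1) → Letter n → ℤ, ∀ x, m x - m' x = ∑ k, sgnTab (x k) * H k (k.removeNth x) := by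
  have hsub : ∀ ε : Eps (n + 1), vmoment (fun x => m x - m' x) ε = vmoment m ε - vmoment m' ε := by
    intro ε; unfold vmoment; rw [← Finset.sum_sub_distrib]
    exact Finset.sum_congr rfl (fun x _ => by push_cast; ring)
  refine (pure_dead_iff_isTwistSum (fun x => m x - m' x)).mp ⟨fun ε hp hm => ?_, ?_⟩
  · rw [hsub, hpure ε hp hm, hpure' ε hp hm, sub_zero]
  · rw [hsub, hW, sub_self]

end Summit.Ventures.HSemireg.SignedWeilDesignN
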